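import Summits.Ventures.Crystal3D.Theorems.StickyWulffConstantTextureLiminfTexShadowResolutionDefs
import Summits.Ventures.Crystal3D.Theorems.StickyWulffConstantNoReconstructionGainRimCount
import HarnessLib

/-!
# `BarlowResolution` from `L12Local` and CUBE RIGIDITY: the counting half of `stub_resolution`
# (lane T, crux `TextureLiminf`, stmt-Ventures-19483; registered line `TexShadow`, stub `stub_resolution` [L])

HONEST FRAMING. Venture `Summits/Ventures/Crystal3D` (cell `crystal3d-full`), helper `--supports` the crux
`TextureLiminf` (stmt-Ventures-19483) of `route-Ventures-StickyWulffConstant`, registered line `TexShadow`.  Rung credit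
only; F-C1 not moved.  NOT `stub_resolution` itself: its reduction to the named geometric core `CubeRigidity`
(`…TexShadowResolutionDefs`), which is carried as a HYPOTHESIS (the audit's `conditional-result`).

PROOF OF THE REDUCTION.  Given `K, δ, M`, take the margin `D` of `CubeRigidity M`.  (1) DEFECTS: under `L12Local` every ball
without a close-packed shell has `≠ 12` contacts or a contact neighbour with `≠ 12` contacts, so `#nonClosePacked ≤ 12·Σᵢ(12 − degᵢ)
= 24·(6N − C) ≤ 24K·N^{2/3}` (`card_le_of_localTwelve`, `sum_twelve_sub_coordination_add`).  (2) GRID: ball `i` lies in the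
half-open grid cube with corner `M·⌊xᵢ/M⌋`; distinct grid corners give disjoint cubes.  (3) SPOILING: ball `i` is LOST if some
defective ball lies in the `D`-neighbourhood of its cube; then the two are within `2(M + D)` of each other, and around one defective
ball at most `(4(M+D) + 1)³` balls of a unit packing lie that close (`card_le_of_separated_annulus`, r = 1) — so
`#lost ≤ 24K·(4(M+D)+1)³·N^{2/3} ≤ δN` for `N ≥ N₀(K, δ, M)`.  (4) Every other ball's cube satisfies the hypothesis of `CubeRigidity`,
which supplies its stacking; the cubes of the resolution are the grid cubes of the balls kept.

* **`barlowResolution_of_cubeRigidity : L12Local → CubeRigidity → BarlowResolution`**.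
WHAT THIS IS NOT: not `CubeRigidity` (the multi-file sequel); F-C1 not moved.
-/

noncomputable section

namespace Summit.Ventures.Crystal3D.Theorems

open Finset Metric
open Literature.MathematicalPhysics.StatisticalMechanics (IsHaggSeq)
open Summit.Ventures.Crystal3D.Cruxes.TextureLiminf.TexShadow (E3 stacking cube BarlowResolution CubeRigidity)

/-! ## Grid cubes -/

/-- The grid corner of a point at mesh `M`: `M·⌊p_t / M⌋` coordinatewise. -/
def gridCorner (M : ℝ) (p : E3) : E3 := WithLp.toLp 2 fun t => M * (⌊p t / M⌋ : ℝ)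

/-- Coordinates of the grid corner. -/
theorem gridCorner_apply (M : ℝ) (p : E3) (t : Fin 3) : gridCorner M p t = M * (⌊p t / M⌋ : ℝ) := rfl

/-- A point lies in its own grid cube. -/
theorem mem_cube_gridCorner {M : ℝ} (hM : 0 < M) (p : E3) : p ∈ cube (gridCorner M p) M := by
  intro t
  rw [gridCorner_apply]
  have h1 : (⌊p t / M⌋ : ℝ) ≤ p t / M := Int.floor_le _
  have h2 : p t / M < (⌊p t / M⌋ : ℝ) + 1 := Int.lt_floor_add_one _
  constructor
  · have := mul_le_mul_of_nonneg_left h1 hM.le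
    rwa [mul_div_cancel₀ _ hM.ne'] at this
  · have := mul_lt_mul_of_pos_left h2 hM
    rw [mul_div_cancel₀ _ hM.ne', mul_add, mul_one] at this
    exact this

/-- Grid cubes with distinct corners are disjoint. -/
theorem disjoint_cube_gridCorner {M : ℝ} (hM : 0 < M) {p p' : E3} (h : gridCorner M p ≠ gridCorner M p') :
    Disjoint (cube (gridCorner M p) M) (cube (gridCorner M p') M) := by
  rw [Set.disjoint_left]
  intro y hy hy'
  apply h
  -- all three floors agree
  have key : ∀ t : Fin 3, (⌊p t / M⌋ : ℤ) = ⌊p' t / M⌋ := by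
    intro t
    obtain ⟨h1, h2⟩ := hy t
    obtain ⟨h1', h2'⟩ := hy' t
    rw [gridCorner_apply] at h1 h2 h1' h2'
    -- `M k ≤ y < M k + M` and `M k' ≤ y < M k' + M` force `k = k'`
    have hyM : (⌊p t / M⌋ : ℝ) ≤ y t / M ∧ y t / M < (⌊p t / M⌋ : ℝ) + 1 := by
      constructor
      · rw [le_div_iff₀ hM]; linarith
      · rw [div_lt_iff₀ hM]; linarith
    have hyM' : (⌊p' t / M⌋ : ℝ) ≤ y t / M ∧ y t / M < (⌊p' t / M⌋ : ℝ) + 1 := by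
      constructor
      · rw [le_div_iff₀ hM]; linarith
      · rw [div_lt_iff₀ hM]; linarith
    have e1 : ⌊y t / M⌋ = ⌊p t / M⌋ := Int.floor_eq_iff.2 ⟨hyM.1, hyM.2⟩
    have e2 : ⌊y t / M⌋ = ⌊p' t / M⌋ := Int.floor_eq_iff.2 ⟨hyM'.1, hyM'.2⟩
    rw [← e1, ← e2]
  ext t
  rw [gridCorner_apply, gridCorner_apply, key t]

/-- Sup-norm closeness of a point of a grid cube to a point of its `D`-neighbourhood: distance `≤ 2(M + D)`. -/
theorem dist_le_of_mem_cube_of_mem_nbhd {M D : ℝ} (hM : 0 < M) (hD : 0 ≤ D) {q y z : E3} (hy : y ∈ cube q M)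
    (hz : ∀ t : Fin 3, q t - D ≤ z t ∧ z t ≤ q t + M + D) : dist y z ≤ 2 * (M + D) := by
  have hcoord : ∀ t : Fin 3, |y t - z t| ≤ M + D := by
    intro t
    obtain ⟨h1, h2⟩ := hy t
    obtain ⟨h3, h4⟩ := hz t
    rw [abs_le]; constructor <;> linarith
  rw [EuclideanSpace.dist_eq]
  have hsum : ∑ t : Fin 3, dist (y t) (z t) ^ 2 ≤ 3 * (M + D) ^ 2 := by
    have : ∀ t : Fin 3, dist (y t) (z t) ^ 2 ≤ (M + D) ^ 2 := fun t => by
      rw [Real.dist_eq]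
      exact pow_le_pow_left₀ (abs_nonneg _) (hcoord t) 2
    calc ∑ t : Fin 3, dist (y t) (z t) ^ 2 ≤ ∑ _t : Fin 3, (M + D) ^ 2 := Finset.sum_le_sum fun t _ => this t
      _ = 3 * (M + D) ^ 2 := by simp
  have hMD : 0 ≤ M + D := by linarith
  calc Real.sqrt (∑ t : Fin 3, dist (y t) (z t) ^ 2) ≤ Real.sqrt (3 * (M + D) ^ 2) := Real.sqrt_le_sqrt hsum
    _ ≤ Real.sqrt ((2 * (M + D)) ^ 2) := Real.sqrt_le_sqrt (by nlinarith)
    _ = 2 * (M + D) := Real.sqrt_sq (by linarith)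

/-! ## Packing count around one ball -/

/-- In a unit packing at most `(2R + 1)³` balls lie within distance `R ≥ 1` of a given ball (that ball included). -/
theorem card_filter_dist_le {N : ℕ} {x : Fin N → E3} (hx : IsUnitPacking x) (j : Fin N) {R : ℝ} (hR : 1 ≤ R) :
    ((univ.filter fun i => dist (x i) (x j) ≤ R).card : ℝ) ≤ (2 * R + 1) ^ 3 := by
  classical
  -- the others, as a finset of points in the annulus `[1, R]` around `x j`
  set S : Finset (Fin N) := univ.filter fun i => dist (x i) (x j) ≤ R with hS
  set S' : Finset (Fin N) := S.erase j with hS'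
  have hinj : Function.Injective x := hx.injective
  set T : Finset E3 := S'.image x with hT
  have hTcard : T.card = S'.card := Finset.card_image_of_injective _ hinj
  have hmem : ∀ c ∈ T, 1 ≤ dist c (x j) ∧ dist c (x j) ≤ R := by
    intro c hc
    rw [hT, Finset.mem_image] at hc
    obtain ⟨i, hi, rfl⟩ := hc
    rw [hS', Finset.mem_erase] at hi
    obtain ⟨hij, hiS⟩ := hi
    rw [hS, Finset.mem_filter] at hiS
    exact ⟨hx.one_le_dist hij, hiS.2⟩
  have hsep : ∀ c ∈ T, ∀ d ∈ T, c ≠ d → (1 : ℝ) ≤ dist c d := by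
    intro c hc d hd hcd
    rw [hT, Finset.mem_image] at hc hd
    obtain ⟨a, -, rfl⟩ := hc
    obtain ⟨b, -, rfl⟩ := hd
    exact hx.one_le_dist fun h => hcd (by rw [h])
  have hann := card_le_of_separated_annulus T (x j) (r := 1) (R₁ := 1) (R₂ := R) one_pos (by norm_num) hR hmem hsep
  rw [finrank_euclideanSpace_fin] at hann
  -- `#T · (1/2)³ + (1/2)³ ≤ (R + 1/2)³`
  have hT' : (T.card : ℝ) + 1 ≤ (2 * R + 1) ^ 3 := by
    have h8 : ((T.card : ℝ) + 1) * (1 / 8 : ℝ) ≤ (R + 1 / 2) ^ 3 := by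
      norm_num at hann ⊢; linarith
    have : (2 * R + 1) ^ 3 = 8 * (R + 1 / 2) ^ 3 := by ring
    rw [this]; linarith
  -- `#S = #S' + 1`
  have hjS : j ∈ S := by rw [hS, Finset.mem_filter]; exact ⟨Finset.mem_univ _, by rw [dist_self]; linarith⟩
  have hSS' : S'.card + 1 = S.card := by rw [hS']; exact Finset.card_erase_add_one hjS
  calc (S.card : ℝ) = (S'.card : ℝ) + 1 := by exact_mod_cast hSS'.symm
    _ = T.card + 1 := by rw [hTcard]
    _ ≤ (2 * R + 1) ^ 3 := hT'

/-! ## Defect count under `L12Local` -/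

/-- Under `L12Local`: `#nonClosePacked ≤ 24·(6N − C)`. -/
theorem card_nonClosePacked_le (hL : L12Local) {N : ℕ} {x : Fin N → E3} (hx : IsUnitPacking x) :
    ((nonClosePacked x).card : ℝ) ≤ 24 * (6 * (N : ℝ) - (numContacts x : ℝ)) := by
  classical
  have h1 : (nonClosePacked x).card ≤ 12 * ∑ i, (12 - coordination x i) := by
    refine card_le_of_localTwelve hx (nonClosePacked x) fun i hi h12 => ?_
    by_contra hall
    push Not at hall
    exact (mem_nonClosePacked.1 hi) (hL N x hx i h12 hall)
  have h2 := sum_twelve_sub_coordination_add hx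
  -- work in ℕ up to the last step: `#B ≤ 12·Σ(12 − deg)` and `Σ(12 − deg) + 2C = 12N`
  set T : ℕ := ∑ i, (12 - coordination x i) with hT
  have h3 : (T : ℝ) + 2 * (numContacts x : ℝ) = 12 * (N : ℝ) := by
    have := congrArg (fun n : ℕ => (n : ℝ)) h2
    simp only [Nat.cast_add, Nat.cast_mul, Nat.cast_ofNat] at this
    exact this
  have h1' : ((nonClosePacked x).card : ℝ) ≤ 12 * (T : ℝ) := by
    have := (Nat.cast_le (α := ℝ)).2 h1
    rw [Nat.cast_mul, Nat.cast_ofNat] at this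
    exact this
  linarith

/-! ## The reduction -/

/-- **`BarlowResolution` from `L12Local` and `CubeRigidity`.**  See the module docstring. -/
theorem barlowResolution_of_cubeRigidity (hL : L12Local) (hrig : CubeRigidity) : BarlowResolution := by
  classical
  intro K δ M hδ hM
  have hM0 : 0 < M := by linarith
  obtain ⟨D, hD0, hD⟩ := hrig M hM
  -- constants
  set R : ℝ := 2 * (M + D) with hRdef
  have hR1 : 1 ≤ R := by rw [hRdef]; linarith
  set c₁ : ℝ := (2 * R + 1) ^ 3 with hc₁
  have hc₁0 : 0 ≤ c₁ := by rw [hc₁]; positivity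
  set A : ℝ := max 0 (24 * K * c₁ / δ) with hAdef
  have hA0 : 0 ≤ A := le_max_left _ _
  have hAK : 24 * K * c₁ ≤ δ * A := by
    have : 24 * K * c₁ / δ ≤ A := le_max_right _ _
    rw [div_le_iff₀ hδ] at this
    calc 24 * K * c₁ ≤ A * δ := this
      _ = δ * A := mul_comm _ _
  obtain ⟨N₀, hN₀⟩ := exists_nat_ge (A ^ 3)
  refine ⟨N₀, fun N hN x hx hdef => ?_⟩
  -- (1) defects
  set B : Finset (Fin N) := nonClosePacked x with hBdef
  have hB : (B.card : ℝ) ≤ 24 * K * (N : ℝ) ^ ((2 : ℝ) / 3) := by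
    have := card_nonClosePacked_le hL hx
    rw [← hBdef] at this
    nlinarith
  -- (2)/(3) lost and kept balls
  set spoil : Fin N → Fin N → Prop := fun j i =>
    ∀ t : Fin 3, gridCorner M (x i) t - D ≤ x j t ∧ x j t ≤ gridCorner M (x i) t + M + D with hspoil
  set Lost : Finset (Fin N) := univ.filter fun i => ∃ j ∈ B, spoil j i with hLost
  set Good : Finset (Fin N) := univ.filter fun i => ¬ ∃ j ∈ B, spoil j i with hGood
  have hLost_le : (Lost.card : ℝ) ≤ (B.card : ℝ) * c₁ := by
    have hsub : Lost ⊆ B.biUnion fun j => univ.filter fun i => dist (x i) (x j) ≤ R := by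
      intro i hi
      rw [hLost, Finset.mem_filter] at hi
      obtain ⟨j, hjB, hji⟩ := hi.2
      rw [Finset.mem_biUnion]
      refine ⟨j, hjB, Finset.mem_filter.2 ⟨Finset.mem_univ _, ?_⟩⟩
      exact dist_le_of_mem_cube_of_mem_nbhd hM0 hD0 (mem_cube_gridCorner hM0 (x i)) hji
    calc (Lost.card : ℝ) ≤ ((B.biUnion fun j => univ.filter fun i => dist (x i) (x j) ≤ R).card : ℝ) := by
          exact_mod_cast Finset.card_le_card hsub
      _ ≤ ∑ j ∈ B, (((univ.filter fun i => dist (x i) (x j) ≤ R).card : ℕ) : ℝ) := by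
          exact_mod_cast Finset.card_biUnion_le
      _ ≤ ∑ _j ∈ B, c₁ := Finset.sum_le_sum fun j _ => card_filter_dist_le hx j hR1
      _ = (B.card : ℝ) * c₁ := by rw [Finset.sum_const, nsmul_eq_mul]
  have hGood_card : (Good.card : ℝ) = (N : ℝ) - Lost.card := by
    have hsum : Lost.card + Good.card = N := by
      rw [hLost, hGood, Finset.card_filter_add_card_filter_not, Finset.card_univ, Fintype.card_fin]
    have := congrArg (fun n : ℕ => (n : ℝ)) hsum
    simp only [Nat.cast_add] at this
    linarith
  -- (4) the rigidity on every kept ball's cube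
  have hgoodCube : ∀ i ∈ Good, ∀ j : Fin N, (∀ t : Fin 3, gridCorner M (x i) t - D ≤ x j t ∧
      x j t ≤ gridCorner M (x i) t + M + D) → IsClosePackedShell x j := by
    intro i hi j hj
    rw [hGood, Finset.mem_filter] at hi
    by_contra hbad
    exact hi.2 ⟨j, mem_nonClosePacked.2 hbad, hj⟩
  set C : Finset E3 := Good.image fun i => gridCorner M (x i) with hCdef
  have hCmem : ∀ qc ∈ C, ∃ i ∈ Good, gridCorner M (x i) = qc := fun qc hqc => by
    rw [hCdef, Finset.mem_image] at hqc; exact hqc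
  have key : ∀ qc ∈ C, ∃ (L : E3 ≃ₗᵢ[ℝ] E3) (s : E3) (σ : ℤ → ℤ), IsHaggSeq σ ∧
      ∀ i : Fin N, x i ∈ cube qc M → x i ∈ stacking L s σ := by
    intro qc hqc
    obtain ⟨i, hi, rfl⟩ := hCmem qc hqc
    exact hD N x hx (gridCorner M (x i)) (hgoodCube i hi)
  choose! Lf sf σf hσf hstf using key
  -- enumerate the cubes
  set J : ℕ := C.card
  let e : Fin J ≃ {qc // qc ∈ C} := C.equivFin.symm
  refine ⟨J, fun j => (e j : E3), fun j => Lf (e j), fun j => sf (e j), fun j => σf (e j),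
    fun j => hσf _ (e j).2, ?_, ?_, ?_⟩
  · -- disjointness
    intro j j' hjj'
    show Disjoint (cube (e j : E3) M) (cube (e j' : E3) M)
    have hne : ((e j : E3)) ≠ (e j' : E3) := fun h => hjj' (e.injective (Subtype.ext h))
    obtain ⟨i, -, hi⟩ := hCmem _ (e j).2
    obtain ⟨i', -, hi'⟩ := hCmem _ (e j').2
    rw [← hi, ← hi'] at hne ⊢
    exact disjoint_cube_gridCorner hM0 hne
  · -- every ball in a listed cube lies on that cube's stacking
    intro j p hp hpx
    obtain ⟨i, rfl⟩ := hpx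
    exact hstf _ (e j).2 i hp
  · -- the count
    have hsubset : Good ⊆ univ.filter fun i => ∃ j : Fin J, x i ∈ cube (e j : E3) M := by
      intro i hi
      refine Finset.mem_filter.2 ⟨Finset.mem_univ _, ?_⟩
      have hmem : gridCorner M (x i) ∈ C := by rw [hCdef]; exact Finset.mem_image_of_mem _ hi
      refine ⟨e.symm ⟨gridCorner M (x i), hmem⟩, ?_⟩
      rw [Equiv.apply_symm_apply]
      exact mem_cube_gridCorner hM0 (x i)
    have hcount : (Good.card : ℝ) ≤ ((univ.filter fun i => ∃ j : Fin J, x i ∈ cube (e j : E3) M).card : ℝ) := by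
      exact_mod_cast Finset.card_le_card hsubset
    -- `Lost ≤ 24 K c₁ N^{2/3} ≤ δ N`
    have hN1 : (A ^ 3 : ℝ) ≤ N := hN₀.trans (by exact_mod_cast hN)
    have hNnn : (0 : ℝ) ≤ N := Nat.cast_nonneg N
    have hcube : A ≤ (N : ℝ) ^ ((1 : ℝ) / 3) := by
      rw [show ((1 : ℝ) / 3) = ((3 : ℕ) : ℝ)⁻¹ by norm_num]
      calc A = (A ^ 3) ^ (((3 : ℕ) : ℝ)⁻¹) := (Real.pow_rpow_inv_natCast hA0 (by norm_num)).symm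
        _ ≤ (N : ℝ) ^ (((3 : ℕ) : ℝ)⁻¹) := Real.rpow_le_rpow (by positivity) hN1 (by positivity)
    have hsplit : (N : ℝ) ^ ((2 : ℝ) / 3) * (N : ℝ) ^ ((1 : ℝ) / 3) = (N : ℝ) := by
      rcases Nat.eq_zero_or_pos N with hz | hpos
      · subst hz; simp
      · rw [← Real.rpow_add (by exact_mod_cast hpos)]; norm_num
    have h23 : 0 ≤ (N : ℝ) ^ ((2 : ℝ) / 3) := Real.rpow_nonneg hNnn _
    have hlost : (Lost.card : ℝ) ≤ δ * N := by
      calc (Lost.card : ℝ) ≤ (B.card : ℝ) * c₁ := hLost_le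
        _ ≤ 24 * K * (N : ℝ) ^ ((2 : ℝ) / 3) * c₁ := mul_le_mul_of_nonneg_right hB hc₁0
        _ = (24 * K * c₁) * (N : ℝ) ^ ((2 : ℝ) / 3) := by ring
        _ ≤ (δ * A) * (N : ℝ) ^ ((2 : ℝ) / 3) := mul_le_mul_of_nonneg_right hAK h23
        _ ≤ (δ * (N : ℝ) ^ ((1 : ℝ) / 3)) * (N : ℝ) ^ ((2 : ℝ) / 3) :=
            mul_le_mul_of_nonneg_right (mul_le_mul_of_nonneg_left hcube hδ.le) h23
        _ = δ * ((N : ℝ) ^ ((2 : ℝ) / 3) * (N : ℝ) ^ ((1 : ℝ) / 3)) := by ring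
        _ = δ * N := by rw [hsplit]
    rw [hGood_card] at hcount
    linarith

end Summit.Ventures.Crystal3D.Theorems

end
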